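import Summits.QuantumFields.YangMills.Theorems.BalabanUVNodesN07ChartDDerivative
import HarnessLib

/-!
# Route `UnitScaleTilt`, crux K1 «MinimiserStabilityRegPr» (stmt-QuantumFields-19200), stub V2′ `stub_halvingStep` (H), WANTED №g26-1 row **(X4)**:
# **THE CHART REMAINDER `D(A′)` OF [Balaban1985Variational] PROP. 3 IS A HOLOMORPHIC MAP ON THE WEIGHTED BALL — AT THE d = 3 CARRIER, BY NAME**

Cell `ym3-torus` (HUMAN RULING D-0037: YM ladder rung R3 — SU(2) YM₃ on the torus is a RUNG, not the Clay problem), width seat `ym-ust-19200-w3` gen 4 (★★OWNER g26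
ASSIGNMENTS 18 (a)).  `--supports stmt-QuantumFields-19200 --as helper`; def-free, 0 sorry.  NOTHING NEW IS PROVED HERE: the sibling cell pub-ymgap's kernel theorem
`BalabanUVNodes.N07ChartDDerivative.exists_chartD_hasFDerivAt` (DAG node N07, generic carrier `P : Params`; lit-balaban's `B11Prop3Model.Dfix` = implicit function
theorem + Neumann series on the (115)-weighted carriers, fed with (44) `chartRemainder_hCd_hCq`, the `C¹`∕analyticity of `chartLog`, (72)) is READ at `P := F.P K`, `k := K − n`,
fibre `M₂(ℂ)`, in the route's letters (`FlatCubeOpsText.IsLevWeight`, `K0FlatCubeOpsTextP.isLevWeight_iff_T3` is `Iff.rfl`), and then in the DRESSING CONSUMERS' binder shapes.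

WHY (the cell's (165)-A₁ chain).  The (iii) supplier «(98) for the DRESSED current `W = W₀∘(1 − HD) + E`» (`FlatProp4Dressing.hWq_of_dressing`∕`hWd_of_dressing`,
`HalvingDressingLetter…` p607709) displays the chart remainder `D` twice: (55) pointwise (`hD`) AND as a holomorphic MAP (`hDd : DifferentiableOn ℂ D {w 1-ball}`); pillar F4's
`chart47W`∕`chart47_dom` deliver only `∀ A′, ∃! D` (pointwise).  Print p. 286: *«This solution is a limit of uniformly convergent sequence of successive approximations and it
is an analytic function of A′»*; Prop. 3 p. 289: *«The transformation (47) … is defined and analytic for A′ satisfying (43)»*.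

WHAT THIS FILE PROVES (theorems only):
* §1 ★★ `exists_chartD_differentiableOn_T3` — for every member `F`, heights `n, K`, nested family `D` with `D.k = K − n`, `Adm22 D R′ M` (`2L ≤ R′`, `1 ≤ M`), route weights
  `IsLevWeight F n K D w`, and ANY ℂ-linear right inverse `H` of the true linearisation `fderiv ℂ (chartLog η D) 0` (`η = L^{−(K−n)}`) with the guarded `w 1`-sup letter `B₀`
  (e.g. the chart-`H` of record of `ChartHInv.exists_rightInverse₂∕₃` after `Prop8Chart.fderiv_chartLog_zero_apply`), every radius `ε > 0` with `18·C₂·B₀·ε ≤ 1`, `64ε ≤ R⋆`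
  (`R⋆ = (12800·(5L)²·L)⁻¹`, `C₂ = 960·5L·L∕R⋆`, `C₃ = 3840·5L·L∕R⋆`): a map `Dfun` with `DifferentiableOn ℂ Dfun {A′ | ∀ b, w 1 b·‖A′ b‖ < ε}` and, on that ball, (55)
  `‖Dfun A′ i‖ ≤ 4C₂ρ²` for every `w 1`-size bound `ρ ≥ 0`, (49) `C(A′ − H·Dfun A′) = Dfun A′` (`C := chartLog − Qlin`), (48) `chartLog η D (A′ − H·Dfun A′) = Qlin A′`, and
  (73) `∃ 𝔇, HasFDerivAt Dfun 𝔇 A′ ∧ ‖𝔇 W i‖ ≤ 4C₃ε·t` — VERBATIM `exists_chartD_hasFDerivAt` at the carrier.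
* §2 ★★ `exists_chartD_dressingShape_T3` — the same `Dfun`, with the two binders of the dressing consumers LITERALLY: `hDd : DifferentiableOn ℂ Dfun {Y | ∀ b, w 1 b·‖Y b‖ < ε}`
  and `hD : ∀ Y r′, r′ < ε → (∀ b, w 1 b·‖Y b‖ ≤ r′) → (∀ b ν, w 2 b·L^{K−n}·‖Y⟨b₋+e_ν, dir b⟩ − Y b‖ ≤ r′) → ∀ i, ‖Dfun Y i‖ ≤ 4·C₂·r′²` (the gradient premise is not
  needed; `0 ≤ r′` from the nonempty bond set), plus (49)∕(48) on the ball — so the (iii)∕C_E knits take `D := Dfun`, `R := ε` for the SAME `H` they feed.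
HONEST SCOPE: a by-name reading; (73) is at NORM level (no kernel decay — that is (X2-D)'s transpose chain, not here); nothing of [Balaban1985Variational] Sects. D–F is asserted;
NOT a claim about the stub, the crux, the rung or the mass gap.

References: T. Bałaban, CMP **102** (1985) 277–309 [Balaban1985Variational] ((43)–(50) p.285, (55) p.286, (70)–(73) p.289, Prop. 3 p.289, (156)–(157) p.302).
-/

set_option autoImplicit false

noncomputable section

open scoped BigOperators Matrix.Norms.L2Operator

namespace Summit.QuantumFields.YangMills.Theorems.ChartDHolomorphic

open Literature.MathematicalPhysics.QuantumFieldTheory.Balaban1983to89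
open B6SectADomainsV1 (Domains)
open B6SectAOperatorsV1 (BondIdx)
open T3ContinuumYM3Torus (T3Family)
open Summit.QuantumFields.YangMills.Theorems.FlatCubeOpsText (Adm22 IsLevWeight)
open Summit.QuantumFields.YangMills.Theorems.Prop8Chart (chartLog)
open Summit.QuantumFields.YangMills.Theorems.K0FlatCubeOpsTextP (isLevWeight_iff_T3)
open Summit.QuantumFields.YangMills.BalabanUVNodes.N07ChartDDerivative (exists_chartD_hasFDerivAt)

/-! ## §1 `exists_chartD_hasFDerivAt` at the d = 3 carrier, in the route's letters -/

/-- **THE CHART REMAINDER AS A HOLOMORPHIC MAP, AT THE CARRIER** (see the module docstring): [Balaban1985Variational] Prop. 3's `D(·)` for the true multi-level constraint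
`chartLog η D`, `η = L^{−(K−n)}`, and ANY right inverse `H` with the `w 1`-sup letter — `DifferentiableOn ℂ` on the weighted `ε`-ball with (55), (49), (48), (73).
[cite: Balaban1985Variational, (47)-(55) pp.285-286, (70)-(73) p.289, Prop. 3 p.289, (156)-(157) p.302] -/
theorem exists_chartD_differentiableOn_T3 (F : T3Family) (n K : ℕ) (D : Domains (F.P K)) (hDk : D.k = K - n) {R' M : ℕ} (hR'L : 2 * F.L ≤ R') (hM : 1 ≤ M)
    (hAdm : Adm22 D R' M) {w : ℕ → PBond (F.P K) 0 → ℝ} (hw : IsLevWeight F n K D w)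
    (H : (BondIdx D → Matrix (Fin 2) (Fin 2) ℂ) →ₗ[ℂ] (PBond (F.P K) 0 → Matrix (Fin 2) (Fin 2) ℂ))
    (hHinv : ∀ X, (fderiv ℂ (chartLog (((F.L : ℝ)⁻¹) ^ (K - n)) D :
      (PBond (F.P K) 0 → Matrix (Fin 2) (Fin 2) ℂ) → BondIdx D → Matrix (Fin 2) (Fin 2) ℂ) 0) (H X) = X)
    {B₀ : ℝ} (hB₀ : 0 ≤ B₀)
    (hHB : ∀ (X : BondIdx D → Matrix (Fin 2) (Fin 2) ℂ) (t : ℝ), 0 ≤ t → (∀ i, ‖X i‖ ≤ t) → ∀ b, w 1 b * ‖H X b‖ ≤ B₀ * t)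
    {ε : ℝ} (hε : 0 < ε)
    (h18 : 18 * (960 * (((3 + 2) * F.L : ℕ) : ℝ) * (F.L : ℝ) / (12800 * (((3 + 2) * F.L : ℕ) : ℝ) ^ 2 * (F.L : ℝ))⁻¹) * B₀ * ε ≤ 1)
    (h2 : 64 * ε ≤ (12800 * (((3 + 2) * F.L : ℕ) : ℝ) ^ 2 * (F.L : ℝ))⁻¹) :
    ∃ Dfun : (PBond (F.P K) 0 → Matrix (Fin 2) (Fin 2) ℂ) → (BondIdx D → Matrix (Fin 2) (Fin 2) ℂ),
      DifferentiableOn ℂ Dfun {A' : PBond (F.P K) 0 → Matrix (Fin 2) (Fin 2) ℂ | ∀ b, w 1 b * ‖A' b‖ < ε} ∧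
      ∀ A' : PBond (F.P K) 0 → Matrix (Fin 2) (Fin 2) ℂ, (∀ b, w 1 b * ‖A' b‖ < ε) →
        (∀ (ρ : ℝ), 0 ≤ ρ → (∀ b, w 1 b * ‖A' b‖ ≤ ρ) → ∀ i,
          ‖Dfun A' i‖ ≤ 4 * (960 * (((3 + 2) * F.L : ℕ) : ℝ) * (F.L : ℝ) / (12800 * (((3 + 2) * F.L : ℕ) : ℝ) ^ 2 * (F.L : ℝ))⁻¹) * ρ ^ 2) ∧
        chartLog (((F.L : ℝ)⁻¹) ^ (K - n)) D (A' - H (Dfun A')) -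
            (fderiv ℂ (chartLog (((F.L : ℝ)⁻¹) ^ (K - n)) D :
              (PBond (F.P K) 0 → Matrix (Fin 2) (Fin 2) ℂ) → BondIdx D → Matrix (Fin 2) (Fin 2) ℂ) 0) (A' - H (Dfun A')) = Dfun A' ∧
        chartLog (((F.L : ℝ)⁻¹) ^ (K - n)) D (A' - H (Dfun A')) =
            (fderiv ℂ (chartLog (((F.L : ℝ)⁻¹) ^ (K - n)) D :
              (PBond (F.P K) 0 → Matrix (Fin 2) (Fin 2) ℂ) → BondIdx D → Matrix (Fin 2) (Fin 2) ℂ) 0) A' ∧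
        ∃ 𝔇 : (PBond (F.P K) 0 → Matrix (Fin 2) (Fin 2) ℂ) →L[ℂ] (BondIdx D → Matrix (Fin 2) (Fin 2) ℂ), HasFDerivAt Dfun 𝔇 A' ∧
          ∀ (W : PBond (F.P K) 0 → Matrix (Fin 2) (Fin 2) ℂ) (t : ℝ), 0 ≤ t → (∀ b, w 1 b * ‖W b‖ ≤ t) → ∀ i,
            ‖𝔇 W i‖ ≤ 4 * (3840 * (((3 + 2) * F.L : ℕ) : ℝ) * (F.L : ℝ) / (12800 * (((3 + 2) * F.L : ℕ) : ℝ) ^ 2 * (F.L : ℝ))⁻¹) * ε * t := by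
  have hw' : K0FlatCubeOpsTextP.IsLevWeight (F.P K) (K - n) D w := (isLevWeight_iff_T3 F n K D w).2 hw
  exact exists_chartD_hasFDerivAt (P := F.P K) (n := Fin 2) (K - n) hR'L hM D hDk hAdm hw' H hHinv hB₀ hHB hε h18 h2

/-! ## §2 The dressing consumers' binder shapes -/

/-- **THE CHART REMAINDER IN THE DRESSING KNIT'S BINDER SHAPES** (see the module docstring): the `hDd`∕`hD` binders of `FlatProp4Dressing.hWq_of_dressing`∕`hWd_of_dressing`
(at the cube-sequence currency `w₀ = w 1`, `w₁ = w 2·L^{K−n}`, `R := ε`) hold for the holomorphic `Dfun` of §1, together with (49)∕(48) on the ball.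
[cite: Balaban1985Variational, (47)-(55) pp.285-286, Prop. 3 p.289, (80) p.290, (156)-(157) p.302] -/
theorem exists_chartD_dressingShape_T3 (F : T3Family) (n K : ℕ) (D : Domains (F.P K)) (hDk : D.k = K - n) {R' M : ℕ} (hR'L : 2 * F.L ≤ R') (hM : 1 ≤ M)
    (hAdm : Adm22 D R' M) {w : ℕ → PBond (F.P K) 0 → ℝ} (hw : IsLevWeight F n K D w)
    (H : (BondIdx D → Matrix (Fin 2) (Fin 2) ℂ) →ₗ[ℂ] (PBond (F.P K) 0 → Matrix (Fin 2) (Fin 2) ℂ))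
    (hHinv : ∀ X, (fderiv ℂ (chartLog (((F.L : ℝ)⁻¹) ^ (K - n)) D :
      (PBond (F.P K) 0 → Matrix (Fin 2) (Fin 2) ℂ) → BondIdx D → Matrix (Fin 2) (Fin 2) ℂ) 0) (H X) = X)
    {B₀ : ℝ} (hB₀ : 0 ≤ B₀)
    (hHB : ∀ (X : BondIdx D → Matrix (Fin 2) (Fin 2) ℂ) (t : ℝ), 0 ≤ t → (∀ i, ‖X i‖ ≤ t) → ∀ b, w 1 b * ‖H X b‖ ≤ B₀ * t)
    {ε : ℝ} (hε : 0 < ε)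
    (h18 : 18 * (960 * (((3 + 2) * F.L : ℕ) : ℝ) * (F.L : ℝ) / (12800 * (((3 + 2) * F.L : ℕ) : ℝ) ^ 2 * (F.L : ℝ))⁻¹) * B₀ * ε ≤ 1)
    (h2 : 64 * ε ≤ (12800 * (((3 + 2) * F.L : ℕ) : ℝ) ^ 2 * (F.L : ℝ))⁻¹) :
    ∃ Dfun : (PBond (F.P K) 0 → Matrix (Fin 2) (Fin 2) ℂ) → (BondIdx D → Matrix (Fin 2) (Fin 2) ℂ),
      DifferentiableOn ℂ Dfun {Y : PBond (F.P K) 0 → Matrix (Fin 2) (Fin 2) ℂ | ∀ b, w 1 b * ‖Y b‖ < ε} ∧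
      (∀ (Y : PBond (F.P K) 0 → Matrix (Fin 2) (Fin 2) ℂ) (r' : ℝ), r' < ε → (∀ b, w 1 b * ‖Y b‖ ≤ r') →
        (∀ (b : PBond (F.P K) 0) (ν : Fin 3), w 2 b * (F.L : ℝ) ^ (K - n) * ‖Y ⟨b.src.shift ν, b.dir⟩ - Y b‖ ≤ r') → ∀ i,
          ‖Dfun Y i‖ ≤ 4 * (960 * (((3 + 2) * F.L : ℕ) : ℝ) * (F.L : ℝ) / (12800 * (((3 + 2) * F.L : ℕ) : ℝ) ^ 2 * (F.L : ℝ))⁻¹) * r' ^ 2) ∧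
      ∀ A' : PBond (F.P K) 0 → Matrix (Fin 2) (Fin 2) ℂ, (∀ b, w 1 b * ‖A' b‖ < ε) →
        chartLog (((F.L : ℝ)⁻¹) ^ (K - n)) D (A' - H (Dfun A')) -
            (fderiv ℂ (chartLog (((F.L : ℝ)⁻¹) ^ (K - n)) D :
              (PBond (F.P K) 0 → Matrix (Fin 2) (Fin 2) ℂ) → BondIdx D → Matrix (Fin 2) (Fin 2) ℂ) 0) (A' - H (Dfun A')) = Dfun A' ∧
        chartLog (((F.L : ℝ)⁻¹) ^ (K - n)) D (A' - H (Dfun A')) =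
            (fderiv ℂ (chartLog (((F.L : ℝ)⁻¹) ^ (K - n)) D :
              (PBond (F.P K) 0 → Matrix (Fin 2) (Fin 2) ℂ) → BondIdx D → Matrix (Fin 2) (Fin 2) ℂ) 0) A' := by
  obtain ⟨Dfun, hdiff, hball⟩ := exists_chartD_differentiableOn_T3 F n K D hDk hR'L hM hAdm hw H hHinv hB₀ hHB hε h18 h2
  refine ⟨Dfun, hdiff, ?_, fun A' hA' => ⟨(hball A' hA').2.1, (hball A' hA').2.2.1⟩⟩
  intro Y r' hr' h1 _h2 i
  -- the bond set is nonempty, so `0 ≤ r'`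
  have b₀ : PBond (F.P K) 0 := ⟨default, ⟨0, (F.P K).hd⟩⟩
  have hw1 : 0 ≤ w 1 b₀ := by rw [hw 1 b₀]; positivity
  have hr0 : 0 ≤ r' := (mul_nonneg hw1 (norm_nonneg _)).trans (h1 b₀)
  have hY : ∀ b, w 1 b * ‖Y b‖ < ε := fun b => (h1 b).trans_lt hr'
  exact (hball Y hY).1 r' hr0 h1 i

end Summit.QuantumFields.YangMills.Theorems.ChartDHolomorphic

end
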